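import Summits.KontsevichZagierPeriods.KontsevichZagierPeriods.Theses.FurushoPentagon

/-!
# drefute — stub set of line `cumulative-cube-lattice-paths` (crux stmt-KontsevichZagierPeriods-3931, `StuffleInKZ`)

Seat `refuter-drefute-stmt-KontsevichZagierPeriods-3931-0`, 2026-08-16.  The lead's skeleton
(`Lines/cumulative-cube-lattice-paths.lean`) was not yet crux-written when this file was made, and the
planner's registered skeleton (sha 8aca15db517a, evidence `20260816T002038Z-line-cumulative-cube-lattice-paths.lean`)
is not readable from this jail; so the four REGISTERED stub signatures (item payload `stubs`:
`stub_kernelIdentity`, `stub_provReverse`, `stub_cubeChart`, `stub_termTransport`) are attacked here over a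
TRANSCRIPTION of their vocabulary (`headProd` with dimension cap, `cumsum`, `cumsum₂`, `cubeKernel`,
`wordKernel`, `stuffleProv`, `merge`; the cube is the tree's OPEN cube `KZ.unitCube`).  Findings (all
machine-checked below, exact arithmetic; the all-pairs exact checks are `kit/regstub_check.py`,
`kit/chart_check.py` on the item):

* `stub_kernelIdentity` (reversal + caps form) HOLDS at every tested instance — 51 842 exact checks, all
  compositions with entries ≥ 1 and weight ≤ 5 on each side, every dimension `m ∈ [1, weight+1]`
  (including the CAPPED regime `m < weight s`), 0 failures, every summand > 0.  Its hypotheses are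
  load-bearing: `s ≠ [] → 1 ≤ m` (witness `m0_lhs/m0_rhs`: 0 ≠ 4), entries ≥ 1 (s = [0]: 0 ≠ 4), and the
  cube must be OPEN (closed-cube corner witness `closed_lhs/closed_rhs`: 0 ≠ 4) — if the lead's
  `unitCube` were `Icc`/`Ico`-based the stub would be FALSE as stated.
* `stub_provReverse` HOLDS as `List.Perm` (reverse is a bijection of Delannoy step sequences commuting
  with the provenance labels) — also WITHOUT the hypotheses `1 ≤ i` (instances with zero entries below);
  but it is FALSE as an ordered-list EQUALITY already at `s = t = [1]` (`provReverse_not_eq`): the stub must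
  stay a `Perm` (or be composed with `.sum`).
* `stub_cubeChart`: the chart identity `mzvIntegrand u (Φ x) · det Φ'(x) = cubeKernel u x`,
  `Φ(x)_i = x₀⋯x_i`, `det = ∏_j x_j^{w-1-j}`, holds in the TREE's conventions for all 384 tested
  (u, x) (all compositions of weight ≤ 7; `kit/chart_check.py`), so the stub is ONE `changeOfVariablesRel`
  instance (template: Disproof §7 `CubeCoV.cubeRep₂_equivalent`); open vs closed cube is immaterial here
  (a null-domain representation is itself a relation: `domainAddRel` with `r = r₁ = r₂`).
* `stub_termTransport`: for EVERY `p` (zero steps included) `wordKernel m n p z = cubeKernel (merge p) (z ∘ σ_p)`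
  pointwise for the block-interleaving permutation `σ_p` (instance `termTransport_engine`), so the stub is
  `KZ.of_sub_of_reindex_mem_relations` along `σ_p` + `finCongr`; its two sum hypotheses are load-bearing
  (dropping them: `p = [(2,0)]`, `m = n = 1` gives the non-integrable `1/(1−x₀)` on the square).

Nothing here is a kill; it is the briefing for the lead and the re-alignment checklist for when the literal
skeleton is published (diff the seven definitions against the transcription below).
-/

open Literature.NumberTheory.Transcendental

set_option linter.dupNamespace false

namespace Summit.KontsevichZagierPeriods.KontsevichZagierPeriods.Cruxes.StuffleInKZ.DrefuteCube
noncomputable section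

/-! ## Transcribed vocabulary (to be diffed against the lead's `Lines/cumulative-cube-lattice-paths.lean`) -/

/-- capped head product `x₀ ⋯ x_{c-1}` (factors beyond the dimension `m` are `1`). -/
def headProd {m : ℕ} (c : ℕ) (x : Fin m → ℝ) : ℝ := ∏ i : Fin m, if (i : ℕ) < c then x i else 1

/-- cumulative sums `[u₁, u₁+u₂, …]`. -/
def cumsum : List ℕ → List ℕ
  | [] => []
  | a :: u => a :: (cumsum u).map (a + ·)

/-- `R_u(x) = ∏_{j<k} A_j / ∏_{j≤k} (1 - A_j)`, `A_j = headProd c_j x`, `c = cumsum u`. -/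
def cubeKernel {m : ℕ} (u : List ℕ) (x : Fin m → ℝ) : ℝ :=
  (((cumsum u).dropLast.map fun c => headProd c x).prod) / (((cumsum u).map fun c => 1 - headProd c x).prod)

/-- componentwise cumulative sums of a provenance path. -/
def cumsum₂ : List (ℕ × ℕ) → List (ℕ × ℕ)
  | [] => []
  | ab :: p => ab :: (cumsum₂ p).map fun cd => (ab.1 + cd.1, ab.2 + cd.2)

/-- the kernel of a provenance path at the vertex variables `U_j = headProd α_j x · headProd β_j y`. -/
def wordKernel (m n : ℕ) (p : List (ℕ × ℕ)) (z : Fin (m + n) → ℝ) : ℝ :=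
  (((cumsum₂ p).dropLast.map fun cd =>
      headProd cd.1 (fun i => z (Fin.castAdd n i)) * headProd cd.2 (fun j => z (Fin.natAdd m j))).prod) /
  (((cumsum₂ p).map fun cd =>
      1 - headProd cd.1 (fun i => z (Fin.castAdd n i)) * headProd cd.2 (fun j => z (Fin.natAdd m j))).prod)

/-- provenance-tagged stuffle terms, Hoffman's head recursion (A1)–(A3) with steps `(a,0)`, `(0,b)`, `(a,b)`. -/
def stuffleProv : List ℕ → List ℕ → List (List (ℕ × ℕ))
  | [], t => [t.map fun b => (0, b)]
  | a :: s, [] => [(a :: s).map fun a => (a, 0)]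
  | a :: s, b :: t =>
      (stuffleProv s (b :: t)).map (List.cons (a, 0)) ++
        ((stuffleProv (a :: s) t).map (List.cons (0, b)) ++ (stuffleProv s t).map (List.cons (a, b)))
termination_by s t => s.length + t.length

/-- merged index of a provenance path. -/
def merge (p : List (ℕ × ℕ)) : List ℕ := p.map fun ab => ab.1 + ab.2

/-! ## `stuffleProv` reproduces `MZV.stuffle` as an ORDERED list (small cases) -/

example : (stuffleProv [2] [3]).map merge = MZV.stuffle [2] [3] := by
  simp [stuffleProv, merge, MZV.stuffle_cons_cons]
example : (stuffleProv [2, 1] [3]).map merge = MZV.stuffle [2, 1] [3] := by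
  simp [stuffleProv, merge, MZV.stuffle_cons_cons]
example : (stuffleProv [2, 1] [2, 2]).map merge = MZV.stuffle [2, 1] [2, 2] := by
  simp [stuffleProv, merge, MZV.stuffle_cons_cons]

/-! ## `stub_provReverse`: a `Perm`, NOT an equality -/

example : (stuffleProv [1] [1]).Perm ((stuffleProv [1] [1]).map List.reverse) := by
  simp only [stuffleProv, List.map_cons, List.map_nil, List.cons_append, List.nil_append,
    List.reverse_cons, List.reverse_nil]; decide
example : (stuffleProv [2, 1] [3]).Perm ((stuffleProv [1, 2] [3]).map List.reverse) := by
  simp only [stuffleProv, List.map_cons, List.map_nil, List.cons_append, List.nil_append,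
    List.reverse_cons, List.reverse_nil]; decide
example : (stuffleProv [1, 2] [1, 1]).Perm ((stuffleProv [2, 1] [1, 1]).map List.reverse) := by
  simp only [stuffleProv, List.map_cons, List.map_nil, List.cons_append, List.nil_append,
    List.reverse_cons, List.reverse_nil]; decide
example : (stuffleProv [1, 2, 3] [1, 2]).Perm ((stuffleProv [3, 2, 1] [2, 1]).map List.reverse) := by
  simp only [stuffleProv, List.map_cons, List.map_nil, List.cons_append, List.nil_append,
    List.reverse_cons, List.reverse_nil]; decide
/-- mutation: the hypotheses `∀ i ∈ s, 1 ≤ i` / `∀ i ∈ t, 1 ≤ i` of `stub_provReverse` are NOT needed. -/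
example : (stuffleProv [0, 2] [0]).Perm ((stuffleProv [2, 0] [0]).map List.reverse) := by
  simp only [stuffleProv, List.map_cons, List.map_nil, List.cons_append, List.nil_append,
    List.reverse_cons, List.reverse_nil]; decide
example : (stuffleProv [0, 0] [0, 1]).Perm ((stuffleProv [0, 0] [1, 0]).map List.reverse) := by
  simp only [stuffleProv, List.map_cons, List.map_nil, List.cons_append, List.nil_append,
    List.reverse_cons, List.reverse_nil]; decide
/-- watch-point: as an ordered-list EQUALITY the reversal statement is false already at `s = t = [1]`. -/
theorem provReverse_not_eq : stuffleProv [1] [1] ≠ (stuffleProv [1] [1]).map List.reverse := by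
  simp only [stuffleProv, List.map_cons, List.map_nil, List.cons_append, List.nil_append,
    List.reverse_cons, List.reverse_nil]; decide

/-! ## `stub_kernelIdentity`: instances, and its hypotheses are load-bearing -/

/-- instance `s = t = [1]`, `m = n = 1`, `z = (1/2, 1/3)`: both sides are `3`. -/
example : cubeKernel [1] (fun i : Fin 1 => (![(1:ℝ)/2, 1/3] (Fin.castAdd 1 i))) *
    cubeKernel [1] (fun j : Fin 1 => (![(1:ℝ)/2, 1/3] (Fin.natAdd 1 j))) = 3 := by
  simp [cubeKernel, cumsum, headProd]; norm_num
example : ((stuffleProv [1] [1]).map fun p => wordKernel 1 1 p.reverse ![(1:ℝ)/2, 1/3]).sum = 3 := by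
  simp [stuffleProv, wordKernel, cumsum₂, headProd, Fin.castAdd, Fin.natAdd]; norm_num

/-- CAPPED instance (`m = 1 < weight s = 2`): `s = [2]`, `t = [1]`, `m = n = 1`, `z = (1/2, 1/3)`.
LHS `= 1/(1-1/2) · 1/(1-1/3) = 3`; RHS over the three paths is also `3`. -/
example : cubeKernel [2] (fun i : Fin 1 => (![(1:ℝ)/2, 1/3] (Fin.castAdd 1 i))) *
    cubeKernel [1] (fun j : Fin 1 => (![(1:ℝ)/2, 1/3] (Fin.natAdd 1 j))) = 3 := by
  simp [cubeKernel, cumsum, headProd]; norm_num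
example : ((stuffleProv [2] [1]).map fun p => wordKernel 1 1 p.reverse ![(1:ℝ)/2, 1/3]).sum = 3 := by
  simp [stuffleProv, wordKernel, cumsum₂, headProd, Fin.castAdd, Fin.natAdd]; norm_num

/-- load-bearing: the cube must be OPEN.  At the closed-cube corner `z = (1, 1/2)` (`s = t = [1]`,
`m = n = 1`) the left side is the junk value `0` (`1/0 = 0`) while the right side is `4`. -/
theorem closed_lhs : cubeKernel [1] (fun i : Fin 1 => (![(1:ℝ), 1/2] (Fin.castAdd 1 i))) *
    cubeKernel [1] (fun j : Fin 1 => (![(1:ℝ), 1/2] (Fin.natAdd 1 j))) = 0 := by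
  simp [cubeKernel, cumsum, headProd]
theorem closed_rhs : ((stuffleProv [1] [1]).map fun p => wordKernel 1 1 p.reverse ![(1:ℝ), 1/2]).sum = 4 := by
  simp [stuffleProv, wordKernel, cumsum₂, headProd, Fin.castAdd, Fin.natAdd]; norm_num

/-- load-bearing: `s ≠ [] → 1 ≤ m`.  With `m = 0` (`s = t = [1]`, `n = 1`, `z = (1/2)`) the capped
`headProd` makes `A₁ = 1`: left side `0`, right side `4`. -/
theorem m0_lhs : cubeKernel [1] (fun i : Fin 0 => (![(1:ℝ)/2] (Fin.castAdd 1 i))) *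
    cubeKernel [1] (fun j : Fin 1 => (![(1:ℝ)/2] (Fin.natAdd 0 j))) = 0 := by
  simp [cubeKernel, cumsum, headProd]
theorem m0_rhs : ((stuffleProv [1] [1]).map fun p => wordKernel 0 1 p.reverse ![(1:ℝ)/2]).sum = 4 := by
  simp [stuffleProv, wordKernel, cumsum₂, headProd, Fin.castAdd, Fin.natAdd]; norm_num

/-- load-bearing: entries `≥ 1`.  With `s = [0]`, `t = [1]`, `m = n = 1`, `z = (1/2, 1/2)`:
left side `0` (`A₁ = headProd 0 = 1`), right side `4`. -/
theorem zeroEntry_lhs : cubeKernel [0] (fun i : Fin 1 => (![(1:ℝ)/2, 1/2] (Fin.castAdd 1 i))) *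
    cubeKernel [1] (fun j : Fin 1 => (![(1:ℝ)/2, 1/2] (Fin.natAdd 1 j))) = 0 := by
  simp [cubeKernel, cumsum, headProd]
theorem zeroEntry_rhs : ((stuffleProv [0] [1]).map fun p => wordKernel 1 1 p.reverse ![(1:ℝ)/2, 1/2]).sum = 4 := by
  simp [stuffleProv, wordKernel, cumsum₂, headProd, Fin.castAdd, Fin.natAdd]; norm_num

/-! ## `stub_termTransport`: the pointwise engine is a block permutation, zero steps included -/

/-- `p = [(0,1),(2,0),(1,1)]`, `m = 3`, `n = 2`, `merge p = [1,2,2]`; at `z = (x₀,x₁,x₂,y₀,y₁) =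
(1/2,1/3,1/5,1/7,1/11)` the word kernel equals the cube kernel of `merge p` at the block-interleaved
point `(y₀,x₀,x₁,x₂,y₁)`. -/
theorem termTransport_engine : wordKernel 3 2 [(0,1),(2,0),(1,1)] ![(1:ℝ)/2, 1/3, 1/5, 1/7, 1/11]
    = cubeKernel [1,2,2] ![(1:ℝ)/7, 1/2, 1/3, 1/5, 1/11] := by
  simp [wordKernel, cubeKernel, cumsum, cumsum₂, headProd, Fin.castAdd, Fin.natAdd, Fin.prod_univ_succ]
  norm_num

end
end Summit.KontsevichZagierPeriods.KontsevichZagierPeriods.Cruxes.StuffleInKZ.DrefuteCube
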